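import Summits.BirchSwinnertonDyer.BirchSwinnertonDyer.Theorems.ManinLocalTwoThreeDoublingProfileFourP
import Summits.BirchSwinnertonDyer.BirchSwinnertonDyer.Theorems.ManinLocalTwoThreeNoAscendingTamePotGoodThree
import HarnessLib

/-!
# The doubling / tripling profiles at a GENERAL tame level: `4 ∥ N` modulo the index-`4` configuration, `9 ∥ N` modulo index `9`

Summit `BirchSwinnertonDyer`, route `ManinLocalTwoThree` (cell bsd-f2-manin), cruxes C2 `ManinOddAtFour` (stmt-…-22967) and C3
`ManinPrimeToThreeAtNine` (stmt-…-22968).  p3-g6's general-level ledger theorems `index_four_or_velu_two_of_doubled` /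
`index_nine_or_velu_three_of_tripled` (any level with `4 ∣ N`, resp. `9 ∣ N`: a doubled / tripled optimal pair is EITHER in the index-`4` /
index-`9` configuration `Λ₁(f) = 2Λ₀(f)` / `Λ₁(f) = 3Λ₀(f)` (an's E-an-68 case; excluded so far only at `N = 4q`, `9q` with `(ℤ/q)ˣ` cyclic)
OR `W₁` carries the `u = 1` Vélu pair of `W₀`) composed with this seat's local laws — the `4p^k` / `9p^k` profiles (p649022, p649207,
p649990, p651587) at every tame level, MODULO the index configuration:

* `doubling_profile_of_noIndexFour` — `4 ∥ N` (via `exists_isNewformOf`), doubled, not index `4` ⟹ `ord₂ Δ_min(W₀) = 4 ∧ ord₂ Δ_min(W₁) = 8`;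
  `natAbs_maninConstant₀_ne_two_mul_of_IVstar_of_noIndexFour` — no doubling on tame `IV*` off the index-`4` configuration.
* `tripling_profile_of_noIndexNine` — `9 ∥ N`, tripled, not index `9`, `ord₃ j(W₀) ≥ 0` ⟹ (`3, 9`) ∨ (`6`, and then the Vélu line has
  `ord₃ Δ_min(W₁) + 4·ord₃ D₀ = 18`); `natAbs_maninConstant₀_ne_three_mul_of_IIIstar_of_noIndexNine`.

HONEST FRAMING: the index configurations are NOT excluded here (E-an-68 is open beyond cyclic `(ℤ/q)ˣ`); C2, C3, Manin's conjecture and BSD are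
not proved.  No definitions, no named facts, no sorry.  References: [CesnaviciusNeururerSaha2023] Lemma 6.5; [SilvermanATAEC1994] IV.9.4 Table 4.1;
[DiamondShurman2005] Thm. 8.8.1.
-/

set_option autoImplicit false
set_option linter.dupNamespace false

noncomputable section

open scoped Classical
open WeierstrassCurve Literature.NumberTheory.EllipticCurves Literature.NumberTheory.EllipticCurves.ModularForms
open CongruenceSubgroup Polynomial

namespace Summit.BirchSwinnertonDyer.BirchSwinnertonDyer.Theorems.ManinLocalTwoThree

variable {W₁ W₀ : WeierstrassCurve ℚ} [W₁.IsElliptic] [W₁.IsGloballyMinimal] [W₀.IsElliptic] [W₀.IsGloballyMinimal]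
  {N : ℕ} [NeZero N]

/-! ### §1 `4 ∥ N` -/

/-- **No doubling on tame `IV*` off the index-`4` configuration, any level with `4 ∥ N`** (granted `exists_isNewformOf`).
[cite: CesnaviciusNeururerSaha2023, Lemma 6.5] [cite: SilvermanATAEC1994, IV.9.4 Table 4.1] -/
theorem natAbs_maninConstant₀_ne_two_mul_of_IVstar_of_noIndexFour (hnf : exists_isNewformOf)
    (D₁ : Gamma1ParametrizationData W₁ N) (D₀ : ModularParametrizationData W₀ N) (hiso : IsIsogenous W₁ W₀) (h₁ : D₁.IsOptimal)
    (h₀ : ∀ z ∈ D₀.L.lattice, ∃ w ∈ periodLattice D₀.f, z = D₀.c * w) (h4 : 2 ^ 2 ∣ N) (h8 : ¬ 2 ^ 3 ∣ N)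
    (hidx : ¬ ∀ z : ℂ, z ∈ periodLatticeGamma1 D₀.f ↔ ∃ w ∈ periodLattice D₀.f, z = 2 * w)
    (hΔ8 : padicValInt 2 W₀.minimalDiscriminantInt = 8) :
    D₀.maninConstant.natAbs ≠ 2 * D₁.maninConstant.natAbs := by
  intro hdbl
  haveI : Fact (Nat.Prime 2) := ⟨Nat.prime_two⟩
  have hN₀ : N = W₀.conductorNorm ℤ := IsNewformOf.level_eq_conductorNorm_of_exists_isNewformOf hnf D₀.isNewformOf
  have hN₁ : N = W₁.conductorNorm ℤ := IsNewformOf.level_eq_conductorNorm_of_exists_isNewformOf hnf D₁.isNewformOf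
  rcases index_four_or_velu_two_of_doubled D₁ D₀ hiso h₁ h₀ h4 hdbl with h | ⟨q, hq, hc4, hc6⟩
  · exact hidx h
  · have h16 := padicValInt_minimalDiscriminantInt_eq_sixteen_of_velu_two_of_IVstar W₀ (hN₀ ▸ h4) (hN₀ ▸ h8) hΔ8 q hq W₁ hc4 hc6
    rcases padicValInt_minimalDiscriminantInt_eq_four_or_eight_of_tame_two W₁ (hN₁ ▸ h4) (hN₁ ▸ h8) with h | h <;> omega

/-- **The doubling profile off the index-`4` configuration, any level with `4 ∥ N`:** doubled ⟹ `ord₂ Δ_min(W₀) = 4 ∧ ord₂ Δ_min(W₁) = 8`.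
[cite: CesnaviciusNeururerSaha2023, Lemma 6.5] [cite: SilvermanATAEC1994, IV.9.4 Table 4.1] -/
theorem doubling_profile_of_noIndexFour (hnf : exists_isNewformOf)
    (D₁ : Gamma1ParametrizationData W₁ N) (D₀ : ModularParametrizationData W₀ N) (hiso : IsIsogenous W₁ W₀) (h₁ : D₁.IsOptimal)
    (h₀ : ∀ z ∈ D₀.L.lattice, ∃ w ∈ periodLattice D₀.f, z = D₀.c * w) (h4 : 2 ^ 2 ∣ N) (h8 : ¬ 2 ^ 3 ∣ N)
    (hidx : ¬ ∀ z : ℂ, z ∈ periodLatticeGamma1 D₀.f ↔ ∃ w ∈ periodLattice D₀.f, z = 2 * w)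
    (hdbl : D₀.maninConstant.natAbs = 2 * D₁.maninConstant.natAbs) :
    padicValInt 2 W₀.minimalDiscriminantInt = 4 ∧ padicValInt 2 W₁.minimalDiscriminantInt = 8 := by
  haveI : Fact (Nat.Prime 2) := ⟨Nat.prime_two⟩
  have hN₀ : N = W₀.conductorNorm ℤ := IsNewformOf.level_eq_conductorNorm_of_exists_isNewformOf hnf D₀.isNewformOf
  have hΔ4 : padicValInt 2 W₀.minimalDiscriminantInt = 4 := by
    rcases padicValInt_minimalDiscriminantInt_eq_four_or_eight_of_tame_two W₀ (hN₀ ▸ h4) (hN₀ ▸ h8) with h | h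
    · exact h
    · exact absurd hdbl (natAbs_maninConstant₀_ne_two_mul_of_IVstar_of_noIndexFour hnf D₁ D₀ hiso h₁ h₀ h4 h8 hidx h)
  rcases index_four_or_velu_two_of_doubled D₁ D₀ hiso h₁ h₀ h4 hdbl with h | ⟨q, hq, hc4, hc6⟩
  · exact absurd h hidx
  · exact ⟨hΔ4, (exists_isGloballyMinimal_velu_two_of_IV W₀ (hN₀ ▸ h4) (hN₀ ▸ h8) hΔ4 q hq).2 W₁ hc4 hc6⟩

/-! ### §2 `9 ∥ N` -/

/-- **No tripling on pot.-good `III*` off the index-`9` configuration, any level with `9 ∥ N`** (granted `exists_isNewformOf`).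
[cite: CesnaviciusNeururerSaha2023, Lemma 6.5] [cite: SilvermanATAEC1994, IV.9.4 Table 4.1] -/
theorem natAbs_maninConstant₀_ne_three_mul_of_IIIstar_of_noIndexNine (hnf : exists_isNewformOf)
    (D₁ : Gamma1ParametrizationData W₁ N) (D₀ : ModularParametrizationData W₀ N) (hiso : IsIsogenous W₁ W₀) (h₁ : D₁.IsOptimal)
    (h₀ : ∀ z ∈ D₀.L.lattice, ∃ w ∈ periodLattice D₀.f, z = D₀.c * w) (h9 : 3 ^ 2 ∣ N) (h27 : ¬ 3 ^ 3 ∣ N)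
    (hidx : ¬ ∀ z : ℂ, z ∈ periodLatticeGamma1 D₀.f ↔ ∃ w ∈ periodLattice D₀.f, z = 3 * w)
    (hΔ9 : padicValInt 3 W₀.minimalDiscriminantInt = 9) (hj : 0 ≤ padicValRat 3 W₀.j) :
    D₀.maninConstant.natAbs ≠ 3 * D₁.maninConstant.natAbs := by
  intro htri
  have hN₀ : N = W₀.conductorNorm ℤ := IsNewformOf.level_eq_conductorNorm_of_exists_isNewformOf hnf D₀.isNewformOf
  rcases index_nine_or_velu_three_of_tripled D₁ D₀ hiso h₁ h₀ h9 htri with h | ⟨q, hq, hc4, hc6⟩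
  · exact hidx h
  · exact not_exists_isGloballyMinimal_velu_three_of_IIIstar W₀ (hN₀ ▸ h9) (hN₀ ▸ h27) hΔ9 hj q hq ⟨W₁, ‹_›, ‹_›, hc4, hc6⟩

/-- **The tripling profile off the index-`9` configuration, any level with `9 ∥ N`, potentially good `W₀`:** tripled ⟹
(`ord₃ Δ_min(W₀) = 3 ∧ ord₃ Δ_min(W₁) = 9`) ∨ `ord₃ Δ_min(W₀) = 6`.
[cite: CesnaviciusNeururerSaha2023, Lemma 6.5] [cite: SilvermanATAEC1994, IV.9.4 Table 4.1] -/
theorem tripling_profile_of_noIndexNine (hnf : exists_isNewformOf)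
    (D₁ : Gamma1ParametrizationData W₁ N) (D₀ : ModularParametrizationData W₀ N) (hiso : IsIsogenous W₁ W₀) (h₁ : D₁.IsOptimal)
    (h₀ : ∀ z ∈ D₀.L.lattice, ∃ w ∈ periodLattice D₀.f, z = D₀.c * w) (h9 : 3 ^ 2 ∣ N) (h27 : ¬ 3 ^ 3 ∣ N)
    (hidx : ¬ ∀ z : ℂ, z ∈ periodLatticeGamma1 D₀.f ↔ ∃ w ∈ periodLattice D₀.f, z = 3 * w)
    (hj : 0 ≤ padicValRat 3 W₀.j) (htri : D₀.maninConstant.natAbs = 3 * D₁.maninConstant.natAbs) :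
    (padicValInt 3 W₀.minimalDiscriminantInt = 3 ∧ padicValInt 3 W₁.minimalDiscriminantInt = 9) ∨
      padicValInt 3 W₀.minimalDiscriminantInt = 6 := by
  have hN₀ : N = W₀.conductorNorm ℤ := IsNewformOf.level_eq_conductorNorm_of_exists_isNewformOf hnf D₀.isNewformOf
  have h9W : 3 ^ 2 ∣ W₀.conductorNorm ℤ := hN₀ ▸ h9
  have h27W : ¬ 3 ^ 3 ∣ W₀.conductorNorm ℤ := hN₀ ▸ h27
  rcases index_nine_or_velu_three_of_tripled D₁ D₀ hiso h₁ h₀ h9 htri with h | ⟨q, hq, hc4, hc6⟩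
  · exact absurd h hidx
  rcases padicValInt_three_minimalDiscriminantInt_of_nine_dvd_conductorNorm_of_j W₀ h9W h27W hj with h3 | h6 | h9'
  · exact Or.inl ⟨h3, padicValInt_minimalDiscriminantInt_eq_nine_of_velu_three_of_III W₀ h9W h27W h3 q hq W₁ hc4 hc6⟩
  · exact Or.inr h6
  · exact absurd ⟨W₁, ‹_›, ‹_›, hc4, hc6⟩ (not_exists_isGloballyMinimal_velu_three_of_IIIstar W₀ h9W h27W h9' hj q hq)

end Summit.BirchSwinnertonDyer.BirchSwinnertonDyer.Theorems.ManinLocalTwoThree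

end
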